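import Mathlib
import Summits.Ventures.HodgeRepro.Tier4.Line1.RTFSetting
import Summits.Ventures.HodgeRepro.Tier4.Line1.ArchMatrixCoeff
import Summits.Ventures.HodgeRepro.Tier4.Line1.FinLevelCompact
import Summits.Ventures.HodgeRepro.Tier4.Line1.FiniteLevelIsolation

/-!
# Tier4/Line1/OpenInvariantScope — the SCOPE of (S1b) through an open level as a kernel theorem: a non-zero test
function left-invariant under an OPEN subgroup `K` forces `K` compact; on the instance, a non-zero test function
left-invariant under `K_f(N) × G(k_∞)` exists exactly when the archimedean image of `U(W)(𝔸_k)` is compact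

Blind re-derivation cell `pub-hodge-repro`, Tier 4 (README §9–§10), seat t4-L1-p4 (gen 4); the «15-line kernel twin»
of F-L1-ARCH (S13818) that t4-plan-1 g2 asked for (S13820: «land it `--supports` the (S1b) row»).  Target tree path
`lean/Summits/Ventures/HodgeRepro/Tier4/Line1/OpenInvariantScope.lean`.  No printed input.

WHAT IS PROVED.  Generic: `isCompact_of_left_invariant_test` — if `K ≤ G` is open and `f ≠ 0` is a test function with
`f (k g) = f g` for `k ∈ K`, then `K · g₀ ⊆ tsupport f` for any `g₀` with `f g₀ ≠ 0`, so `K ⊆ tsupport f · g₀⁻¹` is a closed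
subset of a compact set (an open subgroup is closed), hence compact.  Instance: **`isCompact_archImage_iff_exists`** —
for `N ≠ 0`, `IsCompact (archImage W)` ⇔ there is a non-zero test function left-invariant under `finLevel W N`
(p2's `K_f(N) × G(k_∞)`): `⇒` is p2's `isTest_indicator_finLevel` (the indicator of `finLevel W N`), `⇐` is the generic
lemma (`finLevel W N` open, `isOpen_finLevel`) plus `archImage W = infPartMat '' finLevel W N` — every element has the
archimedean part of its `G_∞`-factor (`GA.ofInfPart`, FiniteLevelIsolation), which lies in every `finLevel W N`.
So the (S1b) discharges through an open level (`exists_spec_of_level`, `exists_spec_of_archCoeff`, …) are non-vacuous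
EXACTLY on the planes with compact archimedean image — the totally definite ones — and on no other (F-L1-ARCH).
Nothing here says anything about the status of the Hodge conjecture for CM abelian varieties, which is NOT proved
(HC_CM is NOT proved by anyone in this repository).
-/

set_option autoImplicit false

noncomputable section

namespace Summit.Ventures.HodgeRepro.Tier4.Line1

open NumberField IsDedekindDomain Topology Summit.Ventures.HodgeRepro.Tier4.Common
open scoped Pointwise

section Generic

variable {G : Type} [Group G] [TopologicalSpace G] [IsTopologicalGroup G]

/-- **a non-zero test function left-invariant under an open subgroup forces the subgroup compact** -/
theorem isCompact_of_left_invariant_test [T2Space G] {K : Subgroup G} (hK : IsOpen (K : Set G)) {f : G → ℂ}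
    (hf : RTF.IsTest f) (hinv : ∀ k ∈ K, ∀ g, f (k * g) = f g) (hne : f ≠ 0) : IsCompact (K : Set G) := by
  obtain ⟨g₀, hg₀⟩ : ∃ g₀, f g₀ ≠ 0 := by
    by_contra h
    exact hne (funext fun g => by simpa using (not_exists.1 h g))
  have hsub : (K : Set G) ⊆ tsupport f * ({g₀⁻¹} : Set G) := by
    intro k hk
    have hmem : k * g₀ ∈ tsupport f := subset_tsupport f (by
      rw [Function.mem_support, hinv k hk g₀]
      exact hg₀)
    have : k = (k * g₀) * g₀⁻¹ := by group
    rw [this]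
    exact Set.mul_mem_mul hmem (Set.mem_singleton _)
  exact (hf.compact.mul isCompact_singleton).of_isClosed_subset (Subgroup.isClosed_of_isOpen K hK) hsub

end Generic

section Instance

variable {k : Type} [Field k] [NumberField k] (W : PlaneData k)

/-- the archimedean image is the image of `K_f(N) × G(k_∞)` under the archimedean-part map (`g_∞ ∈ finLevel W N`) -/
theorem archImage_subset_image_finLevel (N : ℕ) :
    archImage W ⊆ (fun g : GA W => infPartMat k (GA.mat W g)) '' (finLevel W N : Set (GA W)) := by
  rintro _ ⟨g, rfl⟩
  refine ⟨GA.ofInfPart W g, ?_, ?_⟩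
  · have h := GA.ofInfPart_mem_infinitePart W g
    rw [mem_infinitePart] at h
    have h' : finM k (GA.mat W (GA.ofInfPart W g)⁻¹) = 1 := by
      have e := congrArg (finM k) (GA.mat_inv_mul W (GA.ofInfPart W g))
      rwa [finM_mul, finM_one, h, Matrix.mul_one] at e
    rw [SetLike.mem_coe, mem_finLevel]
    refine ⟨fun i j => ?_, fun i j => ?_⟩
    · rw [mem_finCongrSet, Matrix.sub_apply, map_sub]
      have e1 : finPart k (GA.mat W (GA.ofInfPart W g) i j) = finPart k ((1 : M4 k) i j) :=
        (congrFun (congrFun h i) j).trans (congrFun (congrFun (finM_one (k := k)) i) j).symm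
      rw [e1, sub_self]
      exact zero_mem_modSet k N
    · rw [mem_finCongrSet, Matrix.sub_apply, map_sub]
      have e1 : finPart k (GA.mat W (GA.ofInfPart W g)⁻¹ i j) = finPart k ((1 : M4 k) i j) :=
        (congrFun (congrFun h' i) j).trans (congrFun (congrFun (finM_one (k := k)) i) j).symm
      rw [e1, sub_self]
      exact zero_mem_modSet k N
  · show infPartMat k (GA.mat W (GA.ofInfPart W g)) = infPartMat k (GA.mat W g)
    rw [GA.mat_ofInfPart, ← infM_eq_infPartMat, ← infM_eq_infPartMat, infM_mixM]

/-- the archimedean-part map is continuous -/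
theorem continuous_infPartMat_mat : Continuous fun g : GA W => infPartMat k (GA.mat W g) := by
  refine continuous_matrix fun i j => ?_
  exact continuous_infPart.comp ((Units.continuous_val.comp continuous_subtype_val).matrix_elem i j)

/-- **the archimedean image is compact iff some non-zero test function is left-invariant under `K_f(N) × G(k_∞)`**
(`N ≠ 0`) — the exact scope of the (S1b) discharges through an open level -/
theorem isCompact_archImage_iff_exists {N : ℕ} (hN : N ≠ 0) :
    IsCompact (archImage W) ↔
      ∃ f : GA W → ℂ, RTF.IsTest f ∧ (∀ k ∈ finLevel W N, ∀ g, f (k * g) = f g) ∧ f ≠ 0 := by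
  constructor
  · intro hC
    refine ⟨Set.indicator (finLevel W N : Set (GA W)) fun _ => (1 : ℂ), isTest_indicator_finLevel W hC hN,
      indicator_left_invariant (finLevel W N), ?_⟩
    intro h0
    have h1 := congrFun h0 (1 : GA W)
    rw [Set.indicator_of_mem (Subgroup.one_mem _)] at h1
    exact one_ne_zero h1
  · rintro ⟨f, hf, hinv, hne⟩
    haveI : T2Space (GA W) := t2Space_GA W
    have hK : IsCompact (finLevel W N : Set (GA W)) :=
      isCompact_of_left_invariant_test (isOpen_finLevel W hN) hf hinv hne
    have himg : IsCompact ((fun g : GA W => infPartMat k (GA.mat W g)) '' (finLevel W N : Set (GA W))) :=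
      hK.image (continuous_infPartMat_mat W)
    haveI : T2Space (InfiniteAdeleRing k) := inferInstanceAs (T2Space ((v : InfinitePlace k) → v.Completion))
    refine himg.of_isClosed_subset ?_ (archImage_subset_image_finLevel W N)
    -- `archImage W` is closed: it is the whole image `infPartMat '' finLevel W N` (the other inclusion)
    have heq : archImage W = (fun g : GA W => infPartMat k (GA.mat W g)) '' (finLevel W N : Set (GA W)) := by
      refine Set.Subset.antisymm (archImage_subset_image_finLevel W N) ?_
      rintro _ ⟨g, -, rfl⟩
      exact infPartMat_mem_archImage W g
    rw [heq]
    exact himg.isClosed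

end Instance

end Summit.Ventures.HodgeRepro.Tier4.Line1

end
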